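import Summits.AtomisticToContinuum.FouriersLaw.Theorems.EmbeddedDrudeMourreFGRGapEssGapE
import Summits.AtomisticToContinuum.FouriersLaw.Theorems.EmbeddedDrudeMourreKineticConductivityFiniteSymmetry

/-!
# `FGRGap`, line fold-jet-rigidity, stub `stub_oddEssentialGap` — part F: the local estimate at a base point

Helper file for the crux `Summit.AtomisticToContinuum.FouriersLaw.Theses.EmbeddedDrudeMourre.FGRGap`
(item `stmt-AtomisticToContinuum-12595`), registered stub `stub_oddEssentialGap` (sequel of parts A–E).

`local_estimate`: given the partner map `h` (GA) and fibre genericity (GB), `a > 0`, `b ≥ 0`, and a base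
momentum `x₀`, there are `ε > 0`, `c > 0` and an ERROR FUNCTIONAL `X` with

  `¼ · ofReal (c ∫_{[x₀-ε,x₀+ε]} g² + X(g)) ≤ q(g)`  for every `2π`-periodic measurable `g`, `‖g‖²_{cell} ≤ 1`,
  `X(g_n) → 0`                                        along every weakly-null sequence of such `g_n`.

Construction: GB gives a general-position resonance `(x₀, h, y₀, k₄)` with non-vanishing vertex (`r = b/a`);
GA gives an analytic lift `φ` near `p₀ = (x₀,y₀)`; the charts `Ψ₂ = (k₁, φ)`, `Ψ₄ = (k₁, k₁+φ-k₃)` are local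
diffeomorphisms there (`det = c₃ ≠ 0`, `c₃ - 1 ≠ 0` by general position) and the lifted weight
`W = w(k₁, φ, k₃)` is continuous and positive at `p₀`; on a small closed square `R` around `p₀` all bounds
persist. Then `w·(g₁+g₂-g₃-g₄)² ≥ W g₁² + 2W g₁(g₂-g₃-g₄)` pointwise, the first term integrates to at least
`(W(p₀)/2)(2ε)∫g²` over the first coordinate, and the three cross terms are chart integrals (parts D, E)
dying along weakly-null sequences (part B). Folklore; no named facts.
-/

noncomputable section

open MeasureTheory Set Real Filter Topology
open scoped ENNReal
open Literature.MathematicalPhysics.KineticTheory.PhononBoltzmann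

namespace Summit.AtomisticToContinuum.FouriersLaw.Theorems.FGRGap.FoldJetRigidity.EssGap

/-- The lower-triangular derivative matrix `[1 0; α β]` of a coordinate-pair chart, as a continuous linear
map of `ℝ × ℝ`. -/
local notation3 "chartCLM[" α ", " β "]" =>
  LinearMap.toContinuousLinearMap (Matrix.toLin (Module.Basis.finTwoProd ℝ) (Module.Basis.finTwoProd ℝ)
    !![(1 : ℝ), 0; α, β])

/-- The collision kernel is `2πℤ`-periodic in `k₂`. [folklore] -/
theorem collisionWeight_add_int_mul_k2 (ω₂ a b k₁ k₂ k₃ : ℝ) (n : ℤ) :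
    collisionWeight ω₂ a b k₁ (k₂ + n * (2 * π)) k₃ = collisionWeight ω₂ a b k₁ k₂ k₃ :=
  (KineticConductivityFinite.collisionWeight_periodic₂ ω₂ a b k₁ k₃).int_mul n k₂

/-- A periodic measurable `L²(cell)` function composed with a chart coordinate is square-integrable on
`R` once the lower integral of its square is finite, and the product of two such is integrable when
weighted by a bounded `W` (AM–GM). [folklore] -/
theorem integrable_weight_mul_mul {R : Set (ℝ × ℝ)} (hRm : MeasurableSet R) {W u v : ℝ × ℝ → ℝ} {M : ℝ}
    (hW : AEStronglyMeasurable W (volume.restrict R)) (hWb : ∀ p ∈ R, |W p| ≤ M)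
    (hu : AEStronglyMeasurable u (volume.restrict R)) (hv : AEStronglyMeasurable v (volume.restrict R))
    (hu2 : ∫⁻ p in R, ENNReal.ofReal (u p ^ 2) ≠ ∞) (hv2 : ∫⁻ p in R, ENNReal.ofReal (v p ^ 2) ≠ ∞) :
    Integrable (fun p => W p * (u p * v p)) (volume.restrict R) := by
  have hu2' : Integrable (fun p => u p ^ 2) (volume.restrict R) :=
    (lintegral_ofReal_ne_top_iff_integrable (hu.pow 2) (Eventually.of_forall fun p => sq_nonneg _)).1 hu2
  have hv2' : Integrable (fun p => v p ^ 2) (volume.restrict R) :=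
    (lintegral_ofReal_ne_top_iff_integrable (hv.pow 2) (Eventually.of_forall fun p => sq_nonneg _)).1 hv2
  have hM : ∀ p ∈ R, 0 ≤ M := fun p hp => (abs_nonneg _).trans (hWb p hp)
  refine Integrable.mono' ((hu2'.add hv2').const_mul (|M| / 2)) (hW.mul (hu.mul hv)) ?_
  filter_upwards [ae_restrict_mem hRm] with p hp
  rw [Real.norm_eq_abs, abs_mul, abs_mul]
  have h1 : |u p| * |v p| ≤ (u p ^ 2 + v p ^ 2) / 2 := by
    nlinarith [sq_nonneg (|u p| - |v p|), sq_abs (u p), sq_abs (v p), abs_nonneg (u p), abs_nonneg (v p)]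
  have h2 : |W p| ≤ |M| := (hWb p hp).trans (le_abs_self M)
  calc |W p| * (|u p| * |v p|) ≤ |M| * ((u p ^ 2 + v p ^ 2) / 2) :=
        mul_le_mul h2 h1 (by positivity) (abs_nonneg _)
    _ = |M| / 2 * (u p ^ 2 + v p ^ 2) := by ring

/-! ## The good rectangle around a general-position base point -/

/-- **The good rectangle.** Given the lift clause of GA, the general-position clause of GB, `a > 0`,
`b ≥ 0` and a base momentum `x₀`: a closed square `R = [x₀-ε, x₀+ε] × [y₀-ε, y₀+ε]` (`0 < ε ≤ 1`), a lift
`φ ≡ h (mod 2π)` on `R` with derivative coefficients `c₁, c₃`, the two coordinate-pair charts `e₂ = (k₁, φ)`,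
`e₄ = (k₁, k₁ + φ - k₃)` as open partial homeomorphisms containing `R` in their sources, uniform bounds
`|c₃|, |c₃ - 1| ≥ δ > 0` and `w₀ ≤ w(k₁, φ, k₃) ≤ 4w₀` (`w₀ > 0`) on `R`, continuity on `R`, and a window
index `N` with `R, e₂(R), e₄(R) ⊆ window_N²`. [folklore] -/
theorem exists_good_rectangle {ω₂ : ℝ} (hω : 0 < ω₂) {h : ℝ → ℝ → ℝ}
    (hloc : ∀ k₁ k₃ : ℝ, groupVelocity ω₂ k₃ ≠ groupVelocity ω₂ k₁ →
      ∃ (φ : ℝ × ℝ → ℝ) (U : Set (ℝ × ℝ)), U ∈ 𝓝 (k₁, k₃) ∧ AnalyticOnNhd ℝ φ U ∧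
        φ (k₁, k₃) = h k₁ k₃ ∧ (∀ p ∈ U, ∃ n : ℤ, φ p = h p.1 p.2 + n * (2 * π)) ∧
        (∀ p ∈ U, groupVelocity ω₂ p.2 ≠ groupVelocity ω₂ p.1) ∧
        (∀ p ∈ U, HasStrictFDerivAt φ
          (((groupVelocity ω₂ (p.1 + φ p - p.2) - groupVelocity ω₂ p.1) /
              (groupVelocity ω₂ (φ p) - groupVelocity ω₂ (p.1 + φ p - p.2))) •
              ContinuousLinearMap.fst ℝ ℝ ℝ +
            ((groupVelocity ω₂ p.2 - groupVelocity ω₂ (p.1 + φ p - p.2)) /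
              (groupVelocity ω₂ (φ p) - groupVelocity ω₂ (p.1 + φ p - p.2))) •
              ContinuousLinearMap.snd ℝ ℝ ℝ) p))
    (hgp : ∀ k₁ r : ℝ, 0 ≤ r → ∃ k₃ : ℝ,
      (groupVelocity ω₂ k₁ ≠ groupVelocity ω₂ (h k₁ k₃) ∧ groupVelocity ω₂ k₁ ≠ groupVelocity ω₂ k₃ ∧
        groupVelocity ω₂ k₁ ≠ groupVelocity ω₂ (k₁ + h k₁ k₃ - k₃) ∧
          groupVelocity ω₂ (h k₁ k₃) ≠ groupVelocity ω₂ k₃ ∧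
        groupVelocity ω₂ (h k₁ k₃) ≠ groupVelocity ω₂ (k₁ + h k₁ k₃ - k₃) ∧
          groupVelocity ω₂ k₃ ≠ groupVelocity ω₂ (k₁ + h k₁ k₃ - k₃)) ∧
      vertex 1 r k₁ (h k₁ k₃) k₃ ≠ 0)
    {a b : ℝ} (ha : 0 < a) (hb : 0 ≤ b) (x₀ : ℝ) :
    ∃ (ε y₀ : ℝ) (φ c₃ : ℝ × ℝ → ℝ) (e₂ e₄ : OpenPartialHomeomorph (ℝ × ℝ) (ℝ × ℝ)) (w₀ δ : ℝ) (N : ℕ)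
      (R : Set (ℝ × ℝ)),
      R = Icc (x₀ - ε) (x₀ + ε) ×ˢ Icc (y₀ - ε) (y₀ + ε) ∧ 0 < ε ∧ ε ≤ 1 ∧ 0 < w₀ ∧ 0 < δ ∧
      (∀ p ∈ R, ∃ n : ℤ, φ p = h p.1 p.2 + n * (2 * π)) ∧
      (∀ p ∈ R, c₃ p = (groupVelocity ω₂ p.2 - groupVelocity ω₂ (p.1 + φ p - p.2)) /
        (groupVelocity ω₂ (φ p) - groupVelocity ω₂ (p.1 + φ p - p.2))) ∧
      (∀ p ∈ R, HasStrictFDerivAt φ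
        (((groupVelocity ω₂ (p.1 + φ p - p.2) - groupVelocity ω₂ p.1) /
            (groupVelocity ω₂ (φ p) - groupVelocity ω₂ (p.1 + φ p - p.2))) •
            ContinuousLinearMap.fst ℝ ℝ ℝ + c₃ p • ContinuousLinearMap.snd ℝ ℝ ℝ) p) ∧
      ContinuousOn φ R ∧ ContinuousOn c₃ R ∧
      (∀ p, e₂ p = (p.1, φ p)) ∧ (∀ p, e₄ p = (p.1, p.1 + φ p - p.2)) ∧
      R ⊆ e₂.source ∧ R ⊆ e₄.source ∧
      (∀ p ∈ R, δ ≤ |c₃ p|) ∧ (∀ p ∈ R, δ ≤ |c₃ p - 1|) ∧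
      (∀ p ∈ R, w₀ ≤ collisionWeight ω₂ a b p.1 (φ p) p.2 ∧
        collisionWeight ω₂ a b p.1 (φ p) p.2 ≤ 4 * w₀) ∧
      ContinuousOn (fun p => collisionWeight ω₂ a b p.1 (φ p) p.2) R ∧
      R ⊆ Ioc (-π - N * (2 * π)) (π + N * (2 * π)) ×ˢ Ioc (-π - N * (2 * π)) (π + N * (2 * π)) ∧
      e₂ '' R ⊆ Ioc (-π - N * (2 * π)) (π + N * (2 * π)) ×ˢ Ioc (-π - N * (2 * π)) (π + N * (2 * π)) ∧
      e₄ '' R ⊆ Ioc (-π - N * (2 * π)) (π + N * (2 * π)) ×ˢ Ioc (-π - N * (2 * π)) (π + N * (2 * π)) := by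
  set v := groupVelocity ω₂ with hv_def
  have hvc : Continuous v := Generic.continuous_groupVelocity hω
  -- the general-position point with non-vanishing vertex
  obtain ⟨y₀, ⟨h12, h13, h14, h23, h24, h34⟩, hvert⟩ := hgp x₀ (b / a) (div_nonneg hb ha.le)
  set p₀ : ℝ × ℝ := (x₀, y₀) with hp₀
  -- the lift
  obtain ⟨φ, U, hU, _hφan, hφ0, hφmod, _hUoff, hφder⟩ := hloc x₀ y₀ (Ne.symm h13)
  have hp₀U : p₀ ∈ U := mem_of_mem_nhds hU
  -- the derivative coefficients as functions of `p`
  set κ : ℝ × ℝ → ℝ := fun p => p.1 + φ p - p.2 with hκ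
  set c₃ : ℝ × ℝ → ℝ := fun p => (v p.2 - v (κ p)) / (v (φ p) - v (κ p)) with hc₃
  set c₁ : ℝ × ℝ → ℝ := fun p => (v (κ p) - v p.1) / (v (φ p) - v (κ p)) with hc₁
  have hder : ∀ p ∈ U, HasStrictFDerivAt φ
      (c₁ p • ContinuousLinearMap.fst ℝ ℝ ℝ + c₃ p • ContinuousLinearMap.snd ℝ ℝ ℝ) p :=
    fun p hp => hφder p hp
  -- values at `p₀`
  have hφp₀ : φ p₀ = h x₀ y₀ := hφ0
  have hκp₀ : κ p₀ = x₀ + h x₀ y₀ - y₀ := by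
    show p₀.1 + φ p₀ - p₀.2 = x₀ + h x₀ y₀ - y₀
    rw [hφp₀]
  have h24' : v (φ p₀) - v (κ p₀) ≠ 0 := by rw [hφp₀, hκp₀]; exact sub_ne_zero.mpr h24
  have hc₃p₀ : c₃ p₀ ≠ 0 := by
    simp only [hc₃]
    rw [hφp₀, hκp₀]
    exact div_ne_zero (sub_ne_zero.mpr h34) (sub_ne_zero.mpr h24)
  have hc₃p₀' : c₃ p₀ - 1 ≠ 0 := by
    simp only [hc₃]
    rw [hφp₀, hκp₀, div_sub_one (sub_ne_zero.mpr h24)]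
    refine div_ne_zero ?_ (sub_ne_zero.mpr h24)
    intro h0
    exact h23 (by simp only [hp₀] at h0; linarith)
  -- continuity at `p₀`
  have hφc : ContinuousAt φ p₀ := (hder p₀ hp₀U).continuousAt
  have hκc : ContinuousAt κ p₀ := (continuousAt_fst.add hφc).sub continuousAt_snd
  have hc₃c : ContinuousAt c₃ p₀ := by
    simp only [hc₃]
    exact ((hvc.continuousAt.comp continuousAt_snd).sub (hvc.continuousAt.comp hκc)).div
      ((hvc.continuousAt.comp hφc).sub (hvc.continuousAt.comp hκc)) h24'
  set W : ℝ × ℝ → ℝ := fun p => collisionWeight ω₂ a b p.1 (φ p) p.2 with hW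
  have hWc : ContinuousAt W p₀ := continuousAt_collisionWeight_lift hω a b hφc (by
    have := h24'; rwa [sub_ne_zero] at this)
  have hWp₀ : 0 < W p₀ := by
    simp only [hW]
    refine collisionWeight_pos hω ?_ ?_
    · rw [show φ p₀ = h x₀ y₀ from hφp₀, vertex_eq_mul_vertex_one ha.ne']
      exact mul_ne_zero ha.ne' (by simpa using hvert)
    · have := h24'; rw [sub_ne_zero] at this; exact this
  -- the two charts
  have hΨ₂ : HasStrictFDerivAt (fun q : ℝ × ℝ => (q.1, φ q)) (chartCLM[c₁ p₀, c₃ p₀]) p₀ :=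
    hasStrictFDerivAt_chart2 (hder p₀ hp₀U)
  have hΨ₄ : HasStrictFDerivAt (fun q : ℝ × ℝ => (q.1, q.1 + φ q - q.2)) (chartCLM[1 + c₁ p₀, c₃ p₀ - 1]) p₀ :=
    hasStrictFDerivAt_chart4 (hder p₀ hp₀U)
  obtain ⟨e₂, he₂, he₂s⟩ := exists_openPartialHomeomorph_chart hΨ₂ hc₃p₀
  obtain ⟨e₄, he₄, he₄s⟩ := exists_openPartialHomeomorph_chart hΨ₄ hc₃p₀'
  -- the good neighbourhood
  set δ : ℝ := min (|c₃ p₀| / 2) (|c₃ p₀ - 1| / 2) with hδ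
  have hδpos : 0 < δ := lt_min (by positivity) (by positivity)
  set G : Set (ℝ × ℝ) := U ∩ e₂.source ∩ e₄.source ∩ W ⁻¹' Ioo (W p₀ / 2) (2 * W p₀) ∩
    c₃ ⁻¹' ({c | |c₃ p₀| / 2 < |c|} ∩ {c | |c₃ p₀ - 1| / 2 < |c - 1|}) ∩ φ ⁻¹' Metric.ball (φ p₀) 1 with hG
  have hGn : G ∈ 𝓝 p₀ := by
    refine Filter.inter_mem (Filter.inter_mem (Filter.inter_mem (Filter.inter_mem (Filter.inter_mem hU
      (e₂.open_source.mem_nhds he₂s)) (e₄.open_source.mem_nhds he₄s)) ?_) ?_) ?_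
    · exact hWc.preimage_mem_nhds (isOpen_Ioo.mem_nhds ⟨by linarith, by linarith⟩)
    · refine hc₃c.preimage_mem_nhds (IsOpen.mem_nhds ?_ ⟨?_, ?_⟩)
      · exact (isOpen_lt continuous_const continuous_abs).inter
          (isOpen_lt continuous_const (continuous_id.sub continuous_const).abs)
      · show |c₃ p₀| / 2 < |c₃ p₀|; have := abs_pos.mpr hc₃p₀; linarith
      · show |c₃ p₀ - 1| / 2 < |c₃ p₀ - 1|; have := abs_pos.mpr hc₃p₀'; linarith
    · exact hφc.preimage_mem_nhds (Metric.ball_mem_nhds _ one_pos)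
  obtain ⟨ε₀, hε₀, hball⟩ := Metric.mem_nhds_iff.mp hGn
  set ε : ℝ := min (ε₀ / 2) 1 with hε
  have hεpos : 0 < ε := lt_min (by linarith) one_pos
  have hε1 : ε ≤ 1 := min_le_right _ _
  have hεε₀ : ε < ε₀ := lt_of_le_of_lt (min_le_left _ _) (by linarith)
  set R : Set (ℝ × ℝ) := Icc (x₀ - ε) (x₀ + ε) ×ˢ Icc (y₀ - ε) (y₀ + ε) with hR
  have hRG : R ⊆ G := by
    intro p hp
    apply hball
    rw [Metric.mem_ball, Prod.dist_eq, Real.dist_eq, Real.dist_eq]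
    have h1 : |p.1 - x₀| ≤ ε := abs_le.mpr ⟨by linarith [hp.1.1], by linarith [hp.1.2]⟩
    have h2 : |p.2 - y₀| ≤ ε := abs_le.mpr ⟨by linarith [hp.2.1], by linarith [hp.2.2]⟩
    exact lt_of_le_of_lt (max_le h1 h2) hεε₀
  -- unpacking membership in `G`
  have hRU : R ⊆ U := fun p hp => (hRG hp).1.1.1.1.1
  have hR2 : R ⊆ e₂.source := fun p hp => (hRG hp).1.1.1.1.2
  have hR4 : R ⊆ e₄.source := fun p hp => (hRG hp).1.1.1.2
  have hRW : ∀ p ∈ R, W p₀ / 2 < W p ∧ W p < 2 * W p₀ := fun p hp => (hRG hp).1.1.2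
  have hRc : ∀ p ∈ R, |c₃ p₀| / 2 < |c₃ p| ∧ |c₃ p₀ - 1| / 2 < |c₃ p - 1| := fun p hp => (hRG hp).1.2
  have hRφ : ∀ p ∈ R, dist (φ p) (φ p₀) < 1 := fun p hp => (hRG hp).2
  -- the window index
  set M : ℝ := |x₀| + |y₀| + |h x₀ y₀| + 4 with hM
  set N : ℕ := ⌈M⌉₊ with hN
  have hMN : M ≤ N := Nat.le_ceil M
  have hwin : ∀ u : ℝ, |u| < M → u ∈ Ioc (-π - N * (2 * π)) (π + N * (2 * π)) := by
    intro u hu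
    have hu' := abs_lt.mp hu
    have hN0 : (0 : ℝ) ≤ N := Nat.cast_nonneg N
    constructor <;> nlinarith [Real.pi_gt_three]
  have hcoord : ∀ p ∈ R, |p.1| < M ∧ |p.2| < M ∧ |φ p| < M ∧ |p.1 + φ p - p.2| < M := by
    intro p hp
    have h1 : |p.1 - x₀| ≤ 1 := (abs_le.mpr ⟨by linarith [hp.1.1], by linarith [hp.1.2]⟩).trans hε1
    have h2 : |p.2 - y₀| ≤ 1 := (abs_le.mpr ⟨by linarith [hp.2.1], by linarith [hp.2.2]⟩).trans hε1
    have h3 : |φ p - h x₀ y₀| < 1 := by rw [← hφp₀, ← Real.dist_eq]; exact hRφ p hp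
    have e1 : p.1 = (p.1 - x₀) + x₀ := by ring
    have e2 : p.2 = (p.2 - y₀) + y₀ := by ring
    have e3 : φ p = (φ p - h x₀ y₀) + h x₀ y₀ := by ring
    have a1 : |p.1| ≤ 1 + |x₀| := by rw [e1]; exact (abs_add_le _ _).trans (by linarith)
    have a2 : |p.2| ≤ 1 + |y₀| := by rw [e2]; exact (abs_add_le _ _).trans (by linarith)
    have a3 : |φ p| ≤ 1 + |h x₀ y₀| := by rw [e3]; exact (abs_add_le _ _).trans (by linarith)
    have a4 : |p.1 + φ p - p.2| ≤ |p.1| + |φ p| + |p.2| := by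
      calc |p.1 + φ p - p.2| ≤ |p.1 + φ p| + |p.2| := abs_sub _ _
        _ ≤ |p.1| + |φ p| + |p.2| := by linarith [abs_add_le p.1 (φ p)]
    have hx := abs_nonneg x₀; have hy := abs_nonneg y₀; have hh := abs_nonneg (h x₀ y₀)
    refine ⟨by linarith, by linarith, by linarith, by linarith⟩
  -- assemble
  refine ⟨ε, y₀, φ, c₃, e₂, e₄, W p₀ / 2, δ, N, R, rfl, hεpos, hε1, by linarith, hδpos,
    fun p hp => hφmod p (hRU hp), fun p _ => rfl, fun p hp => hder p (hRU hp), ?_, ?_, he₂, he₄, hR2, hR4,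
    fun p hp => (min_le_left _ _).trans (hRc p hp).1.le, fun p hp => (min_le_right _ _).trans (hRc p hp).2.le,
    fun p hp => ⟨(hRW p hp).1.le, by linarith [(hRW p hp).2]⟩, ?_, ?_, ?_, ?_⟩
  · exact fun p hp => (hder p (hRU hp)).continuousAt.continuousWithinAt
  · -- continuity of `c₃` on `R`: the denominator does not vanish there (else `c₃ = 0 < δ`)
    intro p hp
    have hφcp : ContinuousAt φ p := (hder p (hRU hp)).continuousAt
    have hκcp : ContinuousAt κ p := (continuousAt_fst.add hφcp).sub continuousAt_snd
    have hden : v (φ p) - v (κ p) ≠ 0 := by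
      intro h0
      have : c₃ p = 0 := by simp only [hc₃]; rw [h0, div_zero]
      have h' := (hRc p hp).1
      rw [this, abs_zero] at h'
      linarith [abs_nonneg (c₃ p₀)]
    refine ContinuousAt.continuousWithinAt ?_
    simp only [hc₃]
    exact ((hvc.continuousAt.comp continuousAt_snd).sub (hvc.continuousAt.comp hκcp)).div
      ((hvc.continuousAt.comp hφcp).sub (hvc.continuousAt.comp hκcp)) hden
  · -- continuity of `W` on `R`
    intro p hp
    have hφcp : ContinuousAt φ p := (hder p (hRU hp)).continuousAt
    have hden : v (φ p) ≠ v (p.1 + φ p - p.2) := by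
      intro h0
      have : c₃ p = 0 := by simp only [hc₃, hκ]; rw [h0, sub_self, div_zero]
      have h' := (hRc p hp).1
      rw [this, abs_zero] at h'
      linarith [abs_nonneg (c₃ p₀)]
    exact (continuousAt_collisionWeight_lift hω a b hφcp hden).continuousWithinAt
  · intro p hp; exact ⟨hwin _ (hcoord p hp).1, hwin _ (hcoord p hp).2.1⟩
  · rintro _ ⟨p, hp, rfl⟩; rw [he₂]; exact ⟨hwin _ (hcoord p hp).1, hwin _ (hcoord p hp).2.2.1⟩
  · rintro _ ⟨p, hp, rfl⟩; rw [he₄]; exact ⟨hwin _ (hcoord p hp).1, hwin _ (hcoord p hp).2.2.2⟩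

end Summit.AtomisticToContinuum.FouriersLaw.Theorems.FGRGap.FoldJetRigidity.EssGap

namespace Summit.AtomisticToContinuum.FouriersLaw.Theorems.FGRGap.FoldJetRigidity

/-- REGISTERED HELPER STUB `stub_oddEssentialGap_partF` (landing vehicle of this file): the good
rectangle around a general-position fibre point — analytic lift of h, both charts with Jacobians
bounded away from 0, collision weight pinched in [w₀, 4w₀], everything inside one window square.
[folklore] -/
theorem stub_oddEssentialGap_partF :
    ∀ ω₂ : ℝ, 0 < ω₂ → ∀ h : ℝ → ℝ → ℝ,
      (∀ k₁ k₃ : ℝ, groupVelocity ω₂ k₃ ≠ groupVelocity ω₂ k₁ →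
        ∃ (φ : ℝ × ℝ → ℝ) (U : Set (ℝ × ℝ)), U ∈ 𝓝 (k₁, k₃) ∧ AnalyticOnNhd ℝ φ U ∧
          φ (k₁, k₃) = h k₁ k₃ ∧ (∀ p ∈ U, ∃ n : ℤ, φ p = h p.1 p.2 + n * (2 * π)) ∧
          (∀ p ∈ U, groupVelocity ω₂ p.2 ≠ groupVelocity ω₂ p.1) ∧
          (∀ p ∈ U, HasStrictFDerivAt φ
            (((groupVelocity ω₂ (p.1 + φ p - p.2) - groupVelocity ω₂ p.1) /
                (groupVelocity ω₂ (φ p) - groupVelocity ω₂ (p.1 + φ p - p.2))) •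
                ContinuousLinearMap.fst ℝ ℝ ℝ +
              ((groupVelocity ω₂ p.2 - groupVelocity ω₂ (p.1 + φ p - p.2)) /
                (groupVelocity ω₂ (φ p) - groupVelocity ω₂ (p.1 + φ p - p.2))) •
                ContinuousLinearMap.snd ℝ ℝ ℝ) p)) →
      (∀ k₁ r : ℝ, 0 ≤ r → ∃ k₃ : ℝ,
        (groupVelocity ω₂ k₁ ≠ groupVelocity ω₂ (h k₁ k₃) ∧ groupVelocity ω₂ k₁ ≠ groupVelocity ω₂ k₃ ∧
          groupVelocity ω₂ k₁ ≠ groupVelocity ω₂ (k₁ + h k₁ k₃ - k₃) ∧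
            groupVelocity ω₂ (h k₁ k₃) ≠ groupVelocity ω₂ k₃ ∧
          groupVelocity ω₂ (h k₁ k₃) ≠ groupVelocity ω₂ (k₁ + h k₁ k₃ - k₃) ∧
            groupVelocity ω₂ k₃ ≠ groupVelocity ω₂ (k₁ + h k₁ k₃ - k₃)) ∧
        vertex 1 r k₁ (h k₁ k₃) k₃ ≠ 0) →
      ∀ a b : ℝ, 0 < a → 0 ≤ b → ∀ x₀ : ℝ,
      ∃ (ε y₀ : ℝ) (φ c₃ : ℝ × ℝ → ℝ) (e₂ e₄ : OpenPartialHomeomorph (ℝ × ℝ) (ℝ × ℝ)) (w₀ δ : ℝ) (N : ℕ)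
        (R : Set (ℝ × ℝ)),
        R = Set.Icc (x₀ - ε) (x₀ + ε) ×ˢ Set.Icc (y₀ - ε) (y₀ + ε) ∧ 0 < ε ∧ ε ≤ 1 ∧ 0 < w₀ ∧ 0 < δ ∧
        (∀ p ∈ R, ∃ n : ℤ, φ p = h p.1 p.2 + n * (2 * π)) ∧
        (∀ p ∈ R, c₃ p = (groupVelocity ω₂ p.2 - groupVelocity ω₂ (p.1 + φ p - p.2)) /
          (groupVelocity ω₂ (φ p) - groupVelocity ω₂ (p.1 + φ p - p.2))) ∧
        (∀ p ∈ R, HasStrictFDerivAt φ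
          (((groupVelocity ω₂ (p.1 + φ p - p.2) - groupVelocity ω₂ p.1) /
              (groupVelocity ω₂ (φ p) - groupVelocity ω₂ (p.1 + φ p - p.2))) •
              ContinuousLinearMap.fst ℝ ℝ ℝ + c₃ p • ContinuousLinearMap.snd ℝ ℝ ℝ) p) ∧
        ContinuousOn φ R ∧ ContinuousOn c₃ R ∧
        (∀ p, e₂ p = (p.1, φ p)) ∧ (∀ p, e₄ p = (p.1, p.1 + φ p - p.2)) ∧
        R ⊆ e₂.source ∧ R ⊆ e₄.source ∧
        (∀ p ∈ R, δ ≤ |c₃ p|) ∧ (∀ p ∈ R, δ ≤ |c₃ p - 1|) ∧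
        (∀ p ∈ R, w₀ ≤ collisionWeight ω₂ a b p.1 (φ p) p.2 ∧
          collisionWeight ω₂ a b p.1 (φ p) p.2 ≤ 4 * w₀) ∧
        ContinuousOn (fun p => collisionWeight ω₂ a b p.1 (φ p) p.2) R ∧
        R ⊆ Set.Ioc (-π - N * (2 * π)) (π + N * (2 * π)) ×ˢ Set.Ioc (-π - N * (2 * π)) (π + N * (2 * π)) ∧
        e₂ '' R ⊆ Set.Ioc (-π - N * (2 * π)) (π + N * (2 * π)) ×ˢ Set.Ioc (-π - N * (2 * π)) (π + N * (2 * π)) ∧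
        e₄ '' R ⊆ Set.Ioc (-π - N * (2 * π)) (π + N * (2 * π)) ×ˢ Set.Ioc (-π - N * (2 * π)) (π + N * (2 * π)) :=
  fun _ω₂ hω _h hloc hgp _a _b ha hb x₀ => EssGap.exists_good_rectangle hω hloc hgp ha hb x₀

end Summit.AtomisticToContinuum.FouriersLaw.Theorems.FGRGap.FoldJetRigidity

end
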